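import Mathlib
import HarnessLib
import Summits.HubbardSuperconductivity.HubbardSuperconductivity.Theorems.KLProgrammeKLRegimeEngineTowerBlockZeroBaseWtKlEngClosed
import Summits.HubbardSuperconductivity.HubbardSuperconductivity.Theorems.KLProgrammeKLRegimeEngineScaleOneDatumWKlEng
import Summits.HubbardSuperconductivity.HubbardSuperconductivity.Theorems.KLProgrammeKLRegimeEngineScaleOnePartitionFnUnif
import Summits.HubbardSuperconductivity.HubbardSuperconductivity.Theorems.KLProgrammeKLRegimeEngineTowerChernoff

/-!
# Route `KLProgramme` — crux K3 ENGINE (stmt-HubbardSuperconductivity-20437 `KLRegimeEngineV17F2`), stub (b), THE WEIGHTED CONJUNCT «(b)-WT4»: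
# THE WT4 LAW's BASE DATUM MODULO PURE NUMERICS (cell gate-hubbard-kl, seat gate-hubbard-kl-p3 g22, «WT-BASE» file WB4; `baseLawWtF_blockZero_klEng_closed`
# (…BlockZeroBaseWtKlEngClosed, p701078) with its level-`0` weighted datum rows, its kit guard and `Z^{K_n}_{Λ_1}` DISCHARGED from `exists_levelZeroDatumW_klEng`,
# `towerV_le_fourPiece` and `exists_partitionFn_scaleOne_ne_zero_unif`)

WB3 still took as hypotheses: the unit law of the rate-`j_r` carrier `klTowerMeasWtAt … (K_n) 1 1 j_r` at `F_0` (`p ≥ 3`), its four Chernoff/import rows in the kit's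
scaled array, the block-`0` kit guard and `Z^{K_n}_{Λ_1} ≠ 0` — all level-`0` MODEL rows.  With the scale parameter and base amplitudes NAMED (`λ = B·ε_{j₀}`,
`A_b = A₁ε_x/Klam²/B²`, `Q_b = P₁/ε_x²`, `B ≥ 1`, any `j₀`) the weighted datum package supplies the unit law and the degree-2/4 majorants, so the rows follow from
FIVE PURE NUMERICS INEQUALITIES `W·A_b ≤ A′`, `Z·Q_b ≤ Q′`, `W·Z³·A_b·Q_b³ ≤ ι₃`, `W·Z·T₁(|U|+c)/ε_x ≤ ι₁·λ`, `W·Z²·A₁P₁²|U|/ε_x³ ≤ ι₂·λ`; the guard follows from the rows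
and the fifth smallness row; `Z^{K_n}_{Λ_1}` from p701869 (doors folded by `min`).  Prefix: `∀ P, P.WF → ∃ A₁ P₁ T₁ c₀ U₀″ > 0, ∀ G Q c, … c ≤ c₀ → … U ≤ U₀″ → …`.

* **`baseLawWtF_blockZero_klEng_numerics (d R c″)`** ⊢ `∀ p ≥ 3, klTowerMeasWtAt … (K_n) d 1 j_r (2p) / klLevUnitF β M 0 p (d−1) ≤ A_tot·λ^{p−1}·Q_tot^p` — the WT4 law's
  `hlawb` row (with `hNb0`/`hcar` from `klTowerMeasWtAt_one_baseRowsW`, `Z^{K_n}_{Λ_d}` from p699157) is now modulo the regime/doors and PURE NUMERICS only.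
Composition of landed theorems and real algebra; nothing about the model is asserted beyond them; nothing asserts (b), WT4, (ℓ), any stub, K3 or superconductivity.
References: BGM 2006 §2.8 (2.82)–(2.84), (2.93)–(2.98), Lemma 2.5 [cite: BenfattoGiulianiMastropietro2006].
-/

noncomputable section

namespace Summit.HubbardSuperconductivity.HubbardSuperconductivity.Theorems.EngineV8

set_option linter.dupNamespace false -- summit = problem name (single-conjunct summit), D-0017

open Classical
open Real Finset Literature.MathematicalPhysics.QuantumLattice Literature.Probability.LatticeModels GrassmannAlgebra
open Literature.MathematicalPhysics.QuantumLattice.FermiRG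
open Summit.HubbardSuperconductivity.HubbardSuperconductivity.Theorems.KLProgrammeLegKernels
open Summit.HubbardSuperconductivity.HubbardSuperconductivity.Theorems.KLRegimeSplit
open Summit.HubbardSuperconductivity.HubbardSuperconductivity.Theorems.KLRegimeWick
open Summit.HubbardSuperconductivity.HubbardSuperconductivity.Theorems.TwoPointAssembly
open Summit.HubbardSuperconductivity.HubbardSuperconductivity.Theorems.TorusFourierL2
open Summit.HubbardSuperconductivity.HubbardSuperconductivity.Theorems.DispersionFlow
open Summit.HubbardSuperconductivity.HubbardSuperconductivity.Theorems.TwoVolumeSource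
open Summit.HubbardSuperconductivity.HubbardSuperconductivity.Theorems.ScaleZeroDecay
open Literature.Probability.LatticeModels.BattleFederbush

variable {L M : ℕ} [NeZero L] [NeZero M]

/-- **THE WT4 LAW's BASE DATUM ON THE FLOW FRAME MODULO PURE NUMERICS** (see the module docstring; `2 ≤ d ≤ n`, `d − 1 ≤ j_r`, every `p ≥ 3`). [cite: BenfattoGiulianiMastropietro2006, §2.8 (2.82)-(2.84), (2.93)-(2.98), Lemma 2.5 (2.98)] -/
theorem baseLawWtF_blockZero_klEng_numerics (d : ℕ) (R : RenConsts) (c'' : ℝ) (hc'' : 0 < c'') :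
    ∃ Cinc Dinc : ℝ, 1 ≤ Cinc ∧ 1 ≤ Dinc ∧ ∃ Cκ CJ Cα : ℝ, 0 < Cκ ∧ 0 < CJ ∧ 0 < Cα ∧ (R.WF2 → ∃ c₃' : ℝ, 0 < c₃' ∧ ∃ U₀' : ℝ, 0 < U₀' ∧
      -- the level-0 weighted datum's constants and doors (`exists_levelZeroDatumW_klEng P R`), indexed by `P`
      ∀ P : SplitConsts, P.WF → ∃ A₁ P₁ T₁ c₀ U₀'' : ℝ, 0 < A₁ ∧ 0 < P₁ ∧ 0 < T₁ ∧ 0 < c₀ ∧ 0 < U₀'' ∧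
      ∀ (G : GeoConsts) (Q : EngConsts) (c : ℝ), 0 < c → c ≤ klEngC₃6 P R → c ≤ c₃' → c ≤ c₀ →
      ∀ μ ∈ klWindowC, ∀ U : ℝ, 0 < U → U ≤ klEngU₀9 P R c → U ≤ U₀' → U ≤ U₀'' → c'' * U ≤ 1 →
      ∀ β : ℝ, klBetaMin ≤ β → β ≤ Real.exp (c / U ^ 2) →
      ∀ (L M : ℕ) [NeZero L] [NeZero M], klEngL₃ β U ≤ L → klEngM₃ β U L ≤ M →
      ∀ n : ℕ, 1 ≤ n → n ≤ nScales β + 1 → IsKLRegime U c (-(n : ℤ)) →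
        HistP klPredsV17F2 L M G P Q R β U μ 0 n → FrameOK R U (nScales β) μ (klFlowFrameU L M β U μ n) →
        (∀ m, 1 ≤ m → m < n → FlowPieceOscAt L M c'' β U μ m) →
      2 ≤ d → d ≤ n →
      ∀ jr D : ℕ, d - 1 ≤ jr → Fintype.card (SpaceTimeIdx L M × SectorLeg (sectorCount 0)) / 2 ≤ D →
      -- the scale parameter and the base amplitudes are NAMES: `λ = B·ε_{j₀}`, `A_b = A₁ε_x/Klam²/B²`, `Q_b = P₁/ε_x²`
      ∀ (B : ℝ) (j₀ : ℕ), 1 ≤ B → ∀ (lam Ab Qb : ℝ), lam = B * epsCoupling P U j₀ →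
        Ab = A₁ * imagTimeWeight β M / P.Klam ^ 2 / B ^ 2 → Qb = P₁ / imagTimeWeight β M ^ 2 →
      -- the decay name `ᾱ := Cα·M/β`, the pins and the kit names (equational binders)
      ∀ (αb κb crb ccb W Z σ τ ψ Φ : ℝ), αb = Cα * ((M : ℝ) / β) → κb = Real.sqrt (2 * Cκ * klE0) → crb = 81 * CJ * M / β → ccb = 162 * CJ * M / β →
        W = 32 * crb / ccb → Z = imagTimeWeight β M ^ 2 * ccb ^ 2 / 8 → σ = κb ^ 2 / ccb ^ 2 → τ = 4 * exp 4 * κb ^ 2 / ccb ^ 2 →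
        ψ = ccb ^ 2 / κb ^ 2 → Φ = exp 1 * αb * ccb / (κb ^ 2 * crb) →
      ∀ (A' Q' ι₁ ι₂ ι₃ : ℝ), 0 ≤ A' → 0 < Q' →
      -- NUMERICS ONLY: the level-`0` weighted datum's unit law and Chernoff rows follow from the datum package under these five inequalities
      W * Ab ≤ A' → Z * Qb ≤ Q' → W * Z ^ 3 * (Ab * Qb ^ 3) ≤ ι₃ →
      W * Z * (T₁ * (|U| + c) / imagTimeWeight β M) ≤ ι₁ * lam → W * Z ^ 2 * (A₁ * P₁ ^ 2 * |U| / imagTimeWeight β M ^ 3) ≤ ι₂ * lam →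
      -- the five smallness rows (the block-`0` kit guard is DERIVED inside, `towerV_le_fourPiece`)
      4 * σ * lam * Q' < 1 → 2 * lam * τ * Q' ≤ 1 → exp 1 * τ * lam * Q' < 1 →
      Φ * (τ * (ι₁ * lam + ι₂ / (2 * Q') + ι₃ / (4 * Q' ^ 2) + A' * Q' / 4)) < 1 →
      Φ * (exp 1 * τ * (ι₁ * lam) + (exp 1 * τ) ^ 2 * (ι₂ * lam) + (exp 1 * τ) ^ 3 * (ι₃ * lam ^ 2) +
        A' * (exp 1 * τ * Q') * ((exp 1 * τ * lam * Q') ^ 3 / (1 - exp 1 * τ * lam * Q'))) < 1 →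
      -- the read-out constants (equational binders)
      ∀ (Aro Qro Qtot Atot : ℝ), Aro = Cinc * Ab → Qro = Dinc * Qb → Qtot = Dinc * max 1 (max Qro (max (4 * Q') (2 * τ * ψ * Q'))) →
        Atot = Aro + Cinc * (A' * (4 * σ * lam * Q' / (1 - 4 * σ * lam * Q')) +
          exp 1 * (τ * (ι₁ * lam + ι₂ / (2 * Q') + ι₃ / (4 * Q' ^ 2) + A' * Q' / 4)) *
            (Φ * (τ * (ι₁ * lam + ι₂ / (2 * Q') + ι₃ / (4 * Q' ^ 2) + A' * Q' / 4)) /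
              (1 - Φ * (τ * (ι₁ * lam + ι₂ / (2 * Q') + ι₃ / (4 * Q' ^ 2) + A' * Q' / 4)))) / (2 * τ * Q')) →
      ∀ p : ℕ, 3 ≤ p →
        klTowerMeasWtAt L M β U μ (klFlowFrameU L M β U μ n) d 1 jr (2 * p) / klLevUnitF β M 0 p (d - 1) ≤ Atot * lam ^ (p - 1) * Qtot ^ p)
  := by
  obtain ⟨Cinc, Dinc, hCinc, hDinc, Cκ, CJ, Cα, hCκ, hCJ, hCα, hW3⟩ := baseLawWtF_blockZero_klEng_closed d R c'' hc''
  refine ⟨Cinc, Dinc, hCinc, hDinc, Cκ, CJ, Cα, hCκ, hCJ, hCα, fun hR2 => ?_⟩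
  obtain ⟨c₃', hc₃', U₀', hU₀', h⟩ := hW3 hR2
  refine ⟨c₃', hc₃', U₀', hU₀', fun P hP => ?_⟩
  obtain ⟨A₁, P₁, T₁, hA₁, hP₁, hT₁, c₀, hc₀, U₁, hU₁, hDat⟩ := exists_levelZeroDatumW_klEng P R hP hR2
  obtain ⟨c₀', hc₀', U₁', hU₁', hZ'⟩ := exists_partitionFn_scaleOne_ne_zero_unif P R hR2
  refine ⟨A₁, P₁, T₁, min c₀ c₀', min U₁ U₁', hA₁, hP₁, hT₁, lt_min hc₀ hc₀', lt_min hU₁ hU₁', ?_⟩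
  intro G Q c hc hc6 hc₃'c hcc₀ μ hμ U hU hU9 hU₀'U hUU₁ hcU β hβmin hβc L M _ _ hL3 hM3 n hn1 hnN hkl hhist hK hosc hd hdn jr D hjr hD
    B j₀ hB lam Ab Qb hlam hAbeq hQbeq αb κb crb ccb W Z σ τ ψ Φ hαb hκb hcrb hccb hW hZ hσ hτ hψ hΦ A' Q' ι₁ ι₂ ι₃ hA'0 hQ'0
    hrowA hrowQ hrow3 hrow1 hrow2 hx₁ hx₂ hx₃ hy hθ Aro Qro Qtot Atot hAro hQro hQtot hAtot p hp
  have hβ : 0 < β := KLRegimeSplit.pos_of_klBetaMin_le hβmin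
  have hK1 : 1 ≤ P.Klam := hP.1
  have hB0 : 0 < B := lt_of_lt_of_le one_pos hB
  have hεpos : 0 < imagTimeWeight β M := imagTimeWeight_pos_of_pos (M := M) hβ
  have hM0 : (0 : ℝ) < M := Nat.cast_pos.2 (Nat.pos_of_ne_zero (NeZero.ne M))
  have he0 : (0 : ℝ) < klE0 := by norm_num [klE0]
  have hlam0 : 0 < lam := by
    rw [hlam]; unfold epsCoupling
    have : 0 < |U| + U ^ 2 * ((j₀ : ℕ) : ℝ) := by positivity
    positivity
  have hAb0 : 0 ≤ Ab := by rw [hAbeq]; positivity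
  have hQb0 : 0 ≤ Qb := by rw [hQbeq]; positivity
  have hκb0 : 0 < κb := by rw [hκb]; exact Real.sqrt_pos.2 (by positivity)
  have hcrb0 : 0 < crb := by rw [hcrb]; positivity
  have hccb0 : 0 < ccb := by rw [hccb]; positivity
  have hαb0 : 0 < αb := by rw [hαb]; positivity
  have hW0 : 0 < W := by rw [hW]; positivity
  have hZ0 : 0 < Z := by rw [hZ]; positivity
  have hΦ0 : 0 ≤ Φ := by rw [hΦ]; positivity
  have hτ0 : 0 ≤ τ := by rw [hτ]; positivity
  -- the datum package at `(c, U, K_n, j_r)` and `Z^{K_n}_{Λ_1}`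
  obtain ⟨hlaw, hdeg2, hdeg4⟩ := hDat c hc (hcc₀.trans (min_le_left _ _)) μ hμ U hU hU9 (hUU₁.trans (min_le_left _ _)) β hβmin hβc L M hL3 hM3
    (klFlowFrameU L M β U μ n) hK jr
  have hZ1 : hubbardEffPartitionFnCT L M β U μ 0 (klFlowFrameU L M β U μ n) (klScale klE0 1) ≠ 0 :=
    hZ' c hc (hcc₀.trans (min_le_right _ _)) μ hμ U hU hU9 (hUU₁.trans (min_le_right _ _)) β hβmin hβc L M hL3 hM3 (klFlowFrameU L M β U μ n) hK
  -- the rows, DERIVED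
  have hν0 : ∀ m, 0 ≤ klTowerMeasWtAt L M β U μ (klFlowFrameU L M β U μ n) 1 1 jr (2 * m) / klLevUnitF β M 0 m 0 := fun m =>
    div_nonneg (klTowerMeasWtAt_nonneg hβ.le U μ _ 1 1 jr _) (klLevUnitF_pos hβ 0 m 0).le
  have hlawb : ∀ p : ℕ, 3 ≤ p → klTowerMeasWtAt L M β U μ (klFlowFrameU L M β U μ n) 1 1 jr (2 * p) / klLevUnitF β M 0 p 0 ≤ Ab * lam ^ (p - 1) * Qb ^ p := by
    intro p' hp'
    rw [hlam, hAbeq, hQbeq]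
    exact hlaw B hB j₀ p' hp'
  have hprof : ∀ m, 4 ≤ m → m ≤ D → W * Z ^ m * (klTowerMeasWtAt L M β U μ (klFlowFrameU L M β U μ n) 1 1 jr (2 * m) / klLevUnitF β M 0 m 0) ≤
      A' * lam ^ (m - 1) * Q' ^ m := by
    intro m hm _
    calc W * Z ^ m * (klTowerMeasWtAt L M β U μ (klFlowFrameU L M β U μ n) 1 1 jr (2 * m) / klLevUnitF β M 0 m 0)
        ≤ W * Z ^ m * (Ab * lam ^ (m - 1) * Qb ^ m) := mul_le_mul_of_nonneg_left (hlawb m (by omega)) (by positivity)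
      _ = (W * Ab) * lam ^ (m - 1) * (Z * Qb) ^ m := by rw [mul_pow]; ring
      _ ≤ A' * lam ^ (m - 1) * Q' ^ m :=
          mul_le_mul (mul_le_mul_of_nonneg_right hrowA (by positivity)) (pow_le_pow_left₀ (by positivity) hrowQ m) (by positivity) (by positivity)
  have hprof3 : W * Z ^ 3 * (klTowerMeasWtAt L M β U μ (klFlowFrameU L M β U μ n) 1 1 jr (2 * 3) / klLevUnitF β M 0 3 0) ≤ ι₃ * lam ^ 2 := by
    calc W * Z ^ 3 * (klTowerMeasWtAt L M β U μ (klFlowFrameU L M β U μ n) 1 1 jr (2 * 3) / klLevUnitF β M 0 3 0)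
        ≤ W * Z ^ 3 * (Ab * lam ^ (3 - 1) * Qb ^ 3) := mul_le_mul_of_nonneg_left (hlawb 3 le_rfl) (by positivity)
      _ = (W * Z ^ 3 * (Ab * Qb ^ 3)) * lam ^ 2 := by ring
      _ ≤ ι₃ * lam ^ 2 := mul_le_mul_of_nonneg_right hrow3 (by positivity)
  have himp₁ : W * Z ^ 1 * (klTowerMeasWtAt L M β U μ (klFlowFrameU L M β U μ n) 1 1 jr (2 * 1) / klLevUnitF β M 0 1 0) ≤ ι₁ * lam := by
    calc W * Z ^ 1 * (klTowerMeasWtAt L M β U μ (klFlowFrameU L M β U μ n) 1 1 jr (2 * 1) / klLevUnitF β M 0 1 0)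
        ≤ W * Z ^ 1 * (T₁ * (|U| + c) / imagTimeWeight β M) := mul_le_mul_of_nonneg_left hdeg2 (by positivity)
      _ = W * Z * (T₁ * (|U| + c) / imagTimeWeight β M) := by rw [pow_one]
      _ ≤ ι₁ * lam := hrow1
  have himp₂ : W * Z ^ 2 * (klTowerMeasWtAt L M β U μ (klFlowFrameU L M β U μ n) 1 1 jr (2 * 2) / klLevUnitF β M 0 2 0) ≤ ι₂ * lam :=
    (mul_le_mul_of_nonneg_left hdeg4 (by positivity)).trans hrow2
  have hμ0k : ∀ m, 0 ≤ W * Z ^ m * (klTowerMeasWtAt L M β U μ (klFlowFrameU L M β U μ n) 1 1 jr (2 * m) / klLevUnitF β M 0 m 0) := fun m =>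
    mul_nonneg (by positivity) (hν0 m)
  have hguard : Φ * towerV D τ (fun m => W * Z ^ m * (klTowerMeasWtAt L M β U μ (klFlowFrameU L M β U μ n) 1 1 jr (2 * m) / klLevUnitF β M 0 m 0)) < 1 :=
    lt_of_le_of_lt (mul_le_mul_of_nonneg_left
      (towerV_le_fourPiece (μ := fun m => W * Z ^ m * (klTowerMeasWtAt L M β U μ (klFlowFrameU L M β U μ n) 1 1 jr (2 * m) / klLevUnitF β M 0 m 0))
        hτ0 hlam0.le hQ'0.le hA'0 hμ0k himp₁ himp₂ hprof3 hprof hx₃) hΦ0) hθ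
  exact h G P Q c hP hc hc6 hc₃'c μ hμ U hU hU9 hU₀'U hcU β hβmin hβc L M hL3 hM3 n hn1 hnN hkl hhist hK hosc hd hdn hZ1 jr D hjr hD lam Ab Qb hlam0
    hAb0 hQb0 αb κb crb ccb W Z σ τ ψ Φ hαb hκb hcrb hccb hW hZ hσ hτ hψ hΦ A' Q' ι₁ ι₂ ι₃ hA'0 hQ'0 hlawb hprof hprof3 himp₁ himp₂ hx₁ hx₂ hx₃ hy hθ
    hguard Aro Qro Qtot Atot hAro hQro hQtot hAtot p hp

end Summit.HubbardSuperconductivity.HubbardSuperconductivity.Theorems.EngineV8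

end
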